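import Mathlib.Logic.Equiv.Fin.Basic
import Mathlib.RingTheory.Ideal.Height
import Mathlib.RingTheory.Ideal.KrullsHeightTheorem
import Mathlib.RingTheory.Ideal.MinimalPrime.Localization
import Mathlib.RingTheory.Ideal.MinimalPrime.Noetherian
import Summits.ResolutionOfSingularities.ResolutionOfSingularities.Theorems.FrobeniusLadderFRationalResolutionPrimeAdaptedParameters
import Literature.RingTheory.TightClosure.TightClosure
import HarnessLib

/-!
# Extending a height-unmixed family to a system of parameters
(crux `FrobeniusLadder.FRationalResolution`, line `Sketch`)

Stub `exists_isSystemOfParameters_append_of_height` (worker W9-LOC2) of the skeleton `Sketch` for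
crux stmt-ResolutionOfSingularities-15317, theme LOC (F-rationality localizes,
[HochsterHuneke1994, Thm. 4.2 (f)]).  Let `(R, 𝔪)` be a Noetherian local ring of dimension
`d = j + e` and `a : Fin j → R` a family generating a proper ideal all of whose minimal primes have
height exactly `j`.  Then `a` extends to a system of parameters `(a, t)`, `t : Fin e → R`.

Proof.  Greedy prime avoidance, by induction on `e` (generalizing `j`).  If `e = 0` every minimal
prime of `(a)` has height `j = dim R = ht 𝔪`, hence is `𝔪`, so `rad (a) = 𝔪`.  If `e > 0` the
minimal primes `Q₁, …, Q_r` of `(a)` have height `j < ht 𝔪`, so `𝔪 ≠ Qᵢ` and prime avoidance gives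
`y ∈ 𝔪 ∖ ⋃ Qᵢ`; a minimal prime of `(a, y)` strictly contains some `Qᵢ` (height `> j`) and has
height `≤ j + 1` by Krull's height theorem (`height_le_of_mem_minimalPrimes_span_range` of the
sibling `…PrimeAdaptedParameters`), so `(a, y) : Fin (j + 1) → R` is again height-unmixed and
proper, and the induction hypothesis (dimension `(j + 1) + (e - 1)`) applies.
-/

-- single-problem summit: the doubled namespace component is forced
set_option linter.dupNamespace false

namespace Summit.ResolutionOfSingularities.ResolutionOfSingularities.Theorems.FRationalResolution

open IsLocalRing Literature.RingTheory.TightClosure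

/-- One step of the greedy extension: if every minimal prime of `(a)`, `a : Fin j → R`, has height
`j < ht 𝔪`, then there is `y ∈ 𝔪` such that every minimal prime of `(a, y)` has height `j + 1`
(prime avoidance off the finitely many minimal primes of `(a)`, none of which is `𝔪`; a minimal
prime of `(a, y)` strictly contains a minimal prime of `(a)`, and Krull's height theorem bounds its
height above). [folklore] -/
theorem sopExtension_step (R : Type) [CommRing R] [IsNoetherianRing R] [IsLocalRing R] {j : ℕ}
    (a : Fin j → R) (ha : ∀ Q ∈ (Ideal.span (Set.range a)).minimalPrimes, Q.height = j)
    (hj : (j : ℕ∞) < (maximalIdeal R).height) :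
    ∃ y ∈ maximalIdeal R,
      ∀ Q ∈ (Ideal.span (Set.range (Fin.snoc a y : Fin (j + 1) → R))).minimalPrimes,
        Q.height = (j + 1 : ℕ) := by
  have hfin := (Ideal.span (Set.range a)).finite_minimalPrimes_of_isNoetherianRing
  -- prime avoidance: `𝔪` is none of the finitely many minimal primes of `(a)` (height `j < ht 𝔪`)
  have havoid : ¬ ((maximalIdeal R : Set R) ⊆
      ⋃ Q ∈ (Ideal.span (Set.range a)).minimalPrimes, (Q : Set R)) := by
    rw [Ideal.subset_iUnion_iff_mem_of_isMaximal_of_finite hfin (maximalIdeal R) (maximalIdeal R)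
      (fun Q hQ _ _ => hQ.1.1) (maximalIdeal.isMaximal R).ne_top (maximalIdeal.isMaximal R).ne_top]
    intro hm
    rw [ha _ hm] at hj
    exact lt_irrefl _ hj
  obtain ⟨y, hym, hy⟩ := Set.not_subset.mp havoid
  have hy' : ∀ Q ∈ (Ideal.span (Set.range a)).minimalPrimes, y ∉ Q := fun Q hQ hyQ =>
    hy (Set.mem_biUnion hQ hyQ)
  refine ⟨y, hym, fun Q hQ => le_antisymm (height_le_of_mem_minimalPrimes_span_range _ hQ) ?_⟩
  -- a minimal prime `Q` of `(a, y)` strictly contains a minimal prime `Q₀` of `(a)`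
  have := hQ.1.1
  rw [Fin.range_snoc] at hQ
  have hIQ : Ideal.span (Set.range a) ≤ Q := (Ideal.span_mono (Set.subset_insert _ _)).trans hQ.1.2
  obtain ⟨Q₀, hQ₀, hQ₀Q⟩ := Ideal.exists_minimalPrimes_le hIQ
  have := hQ₀.1.1
  have hyQ : y ∈ Q := hQ.1.2 (Ideal.subset_span (Set.mem_insert _ _))
  have hlt : Q₀ < Q := lt_of_le_of_ne hQ₀Q fun h => hy' Q₀ hQ₀ (h ▸ hyQ)
  have h := Ideal.height_strict_mono_of_isPrime hlt
  rw [ha Q₀ hQ₀] at h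
  push_cast
  exact Order.add_one_le_of_lt h

/-- STUB (worker W9-LOC2) — **A HEIGHT-UNMIXED FAMILY EXTENDS TO A SYSTEM OF PARAMETERS.**  In a
Noetherian local ring `(R, 𝔪)` of dimension `j + e`, a family `a : Fin j → R` generating a proper
ideal all of whose minimal primes have height `j` extends to a system of parameters
`(a, t) : Fin (j + e) → R` (greedy prime avoidance, `sopExtension_step`, `e` times; at the end every
minimal prime of `(a, t)` has height `dim R`, hence equals `𝔪`). [folklore; cf. HochsterHuneke1994,
proof of Thm. 4.2 (f)] -/
theorem exists_isSystemOfParameters_append_of_height (R : Type) [CommRing R] [IsNoetherianRing R]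
    [IsLocalRing R] {j e : ℕ} (hd : ringKrullDim R = (j + e : ℕ)) (a : Fin j → R)
    (ha : ∀ Q ∈ (Ideal.span (Set.range a)).minimalPrimes, Q.height = j)
    (ha' : Ideal.span (Set.range a) ≠ ⊤) :
    ∃ t : Fin e → R, IsSystemOfParameters (Fin.append a t) := by
  -- the range of an appended family (Mathlib: `Fin.append u v ∘ finSumFinEquiv = Sum.elim u v`)
  have hra : ∀ {m n : ℕ} (u : Fin m → R) (v : Fin n → R),
      Set.range (Fin.append u v) = Set.range u ∪ Set.range v := fun u v => by
    have e : Fin.append u v ∘ ⇑finSumFinEquiv = Sum.elim u v := Fin.append_comp_sumElim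
    rw [← EquivLike.range_comp (Fin.append u v) finSumFinEquiv, e, Set.Sum.elim_range]
  induction e generalizing j with
  | zero =>
    -- every minimal prime of `(a)` has height `j = dim R`, hence is `𝔪`
    refine ⟨Fin.elim0, isSystemOfParameters_iff_mem_minimalPrimes.mpr ⟨hd, ?_⟩⟩
    rw [hra, Set.range_eq_empty Fin.elim0, Set.union_empty]
    obtain ⟨Q, hQ⟩ := Ideal.nonempty_minimalPrimes ha'
    have := hQ.1.1
    have hQm : Q = maximalIdeal R := by
      refine Ideal.height_eq_ringKrullDim_iff.mp ?_
      rw [hd, ha Q hQ]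
      simp
    rwa [hQm] at hQ
  | succ e ih =>
    -- `ht 𝔪 = dim R = j + (e + 1) > j`: add one element by `sopExtension_step`
    have hm : (maximalIdeal R).height = (j + (e + 1) : ℕ) := by
      have h := (IsLocalRing.maximalIdeal_height_eq_ringKrullDim (R := R)).trans hd
      exact_mod_cast h
    have hj : (j : ℕ∞) < (maximalIdeal R).height := by
      rw [hm]
      exact_mod_cast (by omega : j < j + (e + 1))
    obtain ⟨y, hym, hy⟩ := sopExtension_step R a ha hj
    -- the enlarged family `(a, y) : Fin (j + 1) → R` is proper and height-unmixed: induct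
    have hle : Ideal.span (Set.range (Fin.snoc a y : Fin (j + 1) → R)) ≤ maximalIdeal R := by
      rw [Fin.range_snoc]
      exact Ideal.span_le.mpr
        (Set.insert_subset hym fun x hx => le_maximalIdeal ha' (Ideal.subset_span hx))
    have hne := ne_top_of_le_ne_top (maximalIdeal.isMaximal R).ne_top hle
    have hd' : ringKrullDim R = ((j + 1) + e : ℕ) := by
      rw [hd, Nat.add_right_comm, Nat.add_assoc]
    obtain ⟨t, ht⟩ := ih hd' (Fin.snoc a y) hy hne
    refine ⟨Fin.cons y t, hd, ?_⟩
    have h := ht.2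
    rw [hra, Fin.range_snoc, Set.insert_union, ← Set.union_insert] at h
    rwa [hra, Fin.range_cons]

end Summit.ResolutionOfSingularities.ResolutionOfSingularities.Theorems.FRationalResolution
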